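import Mathlib
import HarnessLib
import Summits.NavierStokesRegularity.NavierStokesRegularity.Theorems.TaylorModelRungThreeReadoutVNodesDeriv
import Summits.NavierStokesRegularity.NavierStokesRegularity.Theorems.TaylorModelRungThreeReadoutVLandBase
import Summits.NavierStokesRegularity.NavierStokesRegularity.Theorems.TaylorModelRungThreeReadoutFlowPackageVTaylor

/-!
# Line `taylor-model` on crux K1b-DR (stmt-NavierStokesRegularity-23954) — G4-v tools: window/polytope lemmas, (F9) with
# an in-step kernel, and the node trajectory of the last sub-step

Tools for the C¹ landing read-out (G4-v, `…ReadoutVLandDeriv`): convexity of the polytope, the window field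
read back (`ofVec (Qw (toVec y) (toVec y)) = Qb y y`), the section functional as a continuous linear map on window
coordinates, linearity of `kapp`, (F9) at an in-step time with an `InStepKer` kernel, and the node trajectory of
the last sub-step in window coordinates.

* `inPoly_segment`, `ofVec_Qw_self`, `exists_sigmaCLM`, `kapp_linear`, `exists_inStepKerAt`, `node_flow_eq`.

MODEL-lattice rung TL-M3 only; nothing here is a statement about the Navier–Stokes equations.
-/

noncomputable section

-- the sub-problem namespace repeats the summit name by design (D-0017)
set_option linter.dupNamespace false

namespace Summit.NavierStokesRegularity.NavierStokesRegularity.Theorems.TaylorModelV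

open Set Finset Metric
open Literature.Analysis.FluidPDE.TaoCascade Literature.Analysis.FluidPDE.TaoCascade.TaylorChain
open Summit.NavierStokesRegularity.NavierStokesRegularity.Theorems.TaylorModelMajorant
open Summit.NavierStokesRegularity.NavierStokesRegularity.Theorems.TaylorModelVector
open Summit.NavierStokesRegularity.NavierStokesRegularity.Theorems.TaylorModelReadout

variable {cd : CertData} {bx : StepBoxes} {rd : RadiiData} {ro : ReadoutData} {φ : Flow}

/-! ### Small tools -/

/-- The polytope is convex: entry segments stay inside. [folklore] -/
theorem inPoly_segment {j : ℕ} {q₀ q : Fin 4 → ℤ → ℝ} (h₀ : InPoly cd j q₀) (h : InPoly cd j q)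
    {σ : ℝ} (hσ : σ ∈ Icc (0:ℝ) 1) : InPoly cd j (q₀ + σ • (q - q₀)) := by
  intro l
  have e : cd.ℓ j l (q₀ + σ • (q - q₀)) - cd.ctr j l =
      (1 - σ) * (cd.ℓ j l q₀ - cd.ctr j l) + σ * (cd.ℓ j l q - cd.ctr j l) := by
    rw [map_add, map_smul, map_sub, smul_eq_mul]; ring
  rw [e]
  calc |(1 - σ) * (cd.ℓ j l q₀ - cd.ctr j l) + σ * (cd.ℓ j l q - cd.ctr j l)|
      ≤ |(1 - σ) * (cd.ℓ j l q₀ - cd.ctr j l)| + |σ * (cd.ℓ j l q - cd.ctr j l)| := abs_add_le _ _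
    _ = (1 - σ) * |cd.ℓ j l q₀ - cd.ctr j l| + σ * |cd.ℓ j l q - cd.ctr j l| := by
        rw [abs_mul, abs_mul, abs_of_nonneg (by linarith [hσ.2]), abs_of_nonneg hσ.1]
    _ ≤ (1 - σ) * cd.rad j l + σ * cd.rad j l := by
        gcongr
        · linarith [hσ.2]
        · exact h₀ l
        · exact hσ.1
        · exact h l
    _ = cd.rad j l := by ring

/-- The window field at a state read back: `ofVec (Qw (toVec y) (toVec y)) = Qb y y`. [folklore] -/
theorem ofVec_Qw_self (y : Fin 4 → ℤ → ℝ) : ofVec cd (Qw cd (toVec cd y) (toVec cd y)) = cd.Qb y y := by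
  rw [Qw, ofVec_toVec, ofVec_toVec, Qb_trunc, trunc_eq_self cd (wsupp_Qb cd _ _)]

/-- The section functional as a continuous linear map on window coordinates ((R0): `σf` reads the window).
[folklore] -/
theorem exists_sigmaCLM {j : ℕ} (hσw : ∀ y : Fin 4 → ℤ → ℝ, cd.σf j y = cd.σf j (trunc cd y)) :
    ∃ a : (Fin (nW cd) → ℝ) →L[ℝ] ℝ, (∀ y, cd.σf j y = a (toVec cd y)) ∧ ∀ x, a x = cd.σf j (ofVec cd x) := by
  refine ⟨LinearMap.toContinuousLinearMap ((cd.σf j).comp (IsLinearMap.mk' (ofVec cd) ⟨ofVec_add cd, ofVec_smul cd⟩)),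
    fun y => ?_, fun x => rfl⟩
  show cd.σf j y = cd.σf j (ofVec cd (toVec cd y))
  rw [ofVec_toVec]; exact hσw y

/-- `kapp A` is linear in the state. [folklore] -/
theorem kapp_linear (A : Ker) : IsLinearMap ℝ (kapp cd A) := by
  constructor
  · intro v w; funext i' k'
    simp only [Pi.add_apply]
    by_cases hk' : -cd.Kb ≤ k' ∧ k' ≤ cd.Ka
    · rw [kapp_apply_of_InW A _ i' hk', kapp_apply_of_InW A v i' hk', kapp_apply_of_InW A w i' hk',
        ← Finset.sum_add_distrib]
      refine Finset.sum_congr rfl fun c _ => ?_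
      rw [toVec_add, Pi.add_apply]; ring
    · rw [kapp_off A _ i' hk', kapp_off A v i' hk', kapp_off A w i' hk', add_zero]
  · intro r v; funext i' k'
    simp only [Pi.smul_apply, smul_eq_mul]
    by_cases hk' : -cd.Kb ≤ k' ∧ k' ≤ cd.Ka
    · rw [kapp_apply_of_InW A _ i' hk', kapp_apply_of_InW A v i' hk', Finset.mul_sum]
      refine Finset.sum_congr rfl fun c _ => ?_
      rw [toVec_smul, Pi.smul_apply, smul_eq_mul]; ring
    · rw [kapp_off A _ i' hk', kapp_off A v i' hk', mul_zero]

/-- **(F9) at an in-step time with an `InStepKer` kernel**: at an outer-hull start `z` of sub-step `(j,s)` and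
`u ∈ [0,h]`, ONE derivative `L` of the window flow (HasFDerivWithinAt on the hull box) with a kernel `K`,
`InStepKer cd bx j s u K`, representing it on the window. [folklore] -/
theorem exists_inStepKerAt (hSN : cd.StageNumerics) (hC : ChainVCore cd bx) {j : ℕ} (hj : j ≤ cd.N₀)
    {s : ℕ} (hs : s < cd.S j) {z : Fin 4 → ℤ → ℝ} (hz : InBox cd (bx.hlo 2 j s) (bx.hhi 2 j s) z)
    {u : ℝ} (hu : u ∈ Icc 0 (cd.h j s)) :
    ∃ (L : (Fin (nW cd) → ℝ) →L[ℝ] (Fin (nW cd) → ℝ)) (K : Ker),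
      HasFDerivWithinAt (fun yv => flowSel (Qw cd) yv u) L
        (Icc (toVec cd (bx.hlo 2 j s)) (toVec cd (bx.hhi 2 j s))) (toVec cd z) ∧
      InStepKer cd bx j s u K ∧
      ∀ (vv : Fin (nW cd) → ℝ) i' k' (hk' : -cd.Kb ≤ k' ∧ k' ≤ cd.Ka),
        L vv (eW cd (i', ⟨k', Finset.mem_Icc.2 hk'⟩)) = kapp cd K (ofVec cd vv) i' k' := by
  obtain ⟨L, hL, -, hcol⟩ := exists_fderiv_directional_of_core hSN hC hj hs hz hu
  classical
  refine ⟨L, fun i' k' i k => if hk' : -cd.Kb ≤ k' ∧ k' ≤ cd.Ka then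
      (if hk : -cd.Kb ≤ k ∧ k ≤ cd.Ka then
        L (Pi.single (eW cd (i, ⟨k, Finset.mem_Icc.2 hk⟩)) 1) (eW cd (i', ⟨k', Finset.mem_Icc.2 hk'⟩)) else 0) else 0,
    hL, ?_, ?_⟩
  · intro i' k' hk1' hk2' i k hk1 hk2
    have hk' : -cd.Kb ≤ k' ∧ k' ≤ cd.Ka := ⟨hk1', hk2'⟩
    have hk : -cd.Kb ≤ k ∧ k ≤ cd.Ka := ⟨hk1, hk2⟩
    simp only [dif_pos hk', dif_pos hk]
    set c : Fin (nW cd) := eW cd (i, ⟨k, Finset.mem_Icc.2 hk⟩) with hc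
    set c' : Fin (nW cd) := eW cd (i', ⟨k', Finset.mem_Icc.2 hk'⟩) with hc'
    refine ⟨z, hz, ?_⟩
    have h1 := hcol c c'
    have e1 : ∀ n, varJet cd.Qb z (basisSt i k) n i' k' = varJet (Qw cd) (toVec cd z) (Pi.single c 1) n c' := by
      intro n
      have h3 := congrFun (toVec_varJet (cd := cd) z (basisSt i k) n) c'
      rw [toVec_basisSt (cd := cd) i hk] at h3
      simp only [toVec, hc', modeOf, shellOf, Equiv.symm_apply_apply] at h3
      rw [← hc'] at h3
      simpa [hc] using h3
    have e3 : cd.ω j k = wW cd j c := by simp [wW, hc, shellOf]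
    have e4 : bx.JU j s i' k' = toVec cd (bx.JU j s) c' := by simp [toVec, hc', modeOf, shellOf]
    rw [e3, e4]
    simp only [e1]
    exact h1
  · intro vv i' k' hk'
    rw [clm_apply_eq_sum_single, kapp, if_pos hk']
    refine Finset.sum_congr rfl fun c _ => ?_
    simp only [dif_pos hk', dif_pos (shellOf_mem cd c), toVec_ofVec, eW_modeOf_shellOf]
    ring

/-! ### The last-sub-step family from the node states and the Poincaré map -/

section Land


/-- The node trajectory in window coordinates is the shifted stage trajectory: for a polytope point `q` and
`t ∈ [0, h (S−1)]`, `flowSel (toVec (φ(q)(Tn (S−1)))) t = toVec (φ(q)(Tn (S−1) + t))`. [folklore] -/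
theorem node_flow_eq (hC : ChainVCore cd bx) (hR : ChainVRadii cd bx rd) (hF : IsFlowPackageV cd bx φ) {j : ℕ} (hj : j ≤ cd.N₀) {q : Fin 4 → ℤ → ℝ} (hq : InPoly cd j q) {t : ℝ} (ht : t ∈ Icc 0 (cd.h j (cd.S j - 1))) :
    flowSel (Qw cd) (toVec cd (stAt φ j q (cd.Tn j (cd.S j - 1)))) t =
      toVec cd (stAt φ j q (cd.Tn j (cd.S j - 1) + t)) := by
  have hS : 1 ≤ cd.S j := (hC j hj).1
  have hs : cd.S j - 1 < cd.S j := Nat.sub_lt hS Nat.one_pos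
  have hTs := ((gridV hC hj).2.1 _ hs).2
  rw [Nat.sub_add_cancel hS] at hTs
  obtain ⟨hsol, -⟩ := (polyInvariantV hC hR hF).1 j hj q hq
  rw [← toVec_stAt_eq_flowSel hF, (polyNode_shift hC hF hj hsol hs.le).2 (cd.Tn j (cd.S j - 1) + t)
    ⟨by linarith [ht.1], by rw [hTs]; linarith [ht.2]⟩, add_sub_cancel_left]

end Land

end Summit.NavierStokesRegularity.NavierStokesRegularity.Theorems.TaylorModelV

end
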